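import Literature.NumberTheory.EllipticCurves.NewformPeriodsCoeffField
import HarnessLib

/-!
# The rank count behind Shimura's `σ`-equivariance of newform periods, in coordinates:
# the KERNEL of evaluation at an eigenform on the rational period homology is EXACTLY the Hecke part

Topic `NumberTheory/EllipticCurves`; continuation of `NewformPeriodsCoeffField.lean` (`PeriodRank`), the abstract half of the PROOF
of Shimura's theorem on the periods of conjugate newforms ([Shimura1977] Thm. 1, plus part; `NewformPeriodsGaloisEquivarianceProofs`).
Abstract linear algebra only (THEOREMS ONLY, no definition): a complex vector space `S` whose dual has a real basis `b = (φ₁, …, φₙ)`,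
endomorphisms `Tᵢ` whose transposes have INTEGER matrices `t i` in the basis `b` (`Tᵢ^∨ φⱼ = ∑ₖ t i j k · φₖ` — the lattice
`ℤφ₁ ⊕ ⋯ ⊕ ℤφₙ` is Hecke-stable), a joint eigenvector `f` (`Tᵢ f = aᵢ f`) with multiplicity one and eigenvalues in a REAL subfield
`K ⊆ ℂ`, whose values `φⱼ(f)` span `ℂ` over `ℝ`. In `b`-coordinates `x ∈ Kⁿ`: the evaluation `x ↦ ∑ₖ xₖ φₖ(f)`; for ANY ring
homomorphism `σ : K → ℂ` and ANY `g ∈ S` the `σ`-TWISTED evaluation `x ↦ ∑ₖ σ(xₖ) φₖ(g)`; the HECKE VECTORS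
`u_{i,j} = (t i j k − δ_{kj} aᵢ)_k ∈ Kⁿ` (coordinates of `(Tᵢ − aᵢ)^∨ φⱼ`) and their `K`-span `U`.

* `sum_twist_heckeVec_eq_zero`, `sum_twist_eq_zero_of_mem_heckeSpan` — if `Tᵢ g = σ(aᵢ) g` for all `i`, the twisted evaluation kills `U`
  (`(Tᵢ^∨ φⱼ)(g) = φⱼ(Tᵢ g)`; the integer matrix is fixed by `σ`).
* ★★ `mem_heckeSpan_of_sum_eq_zero` — EXACTNESS at `f`: `∑ₖ xₖ φₖ(f) = 0 ⟹ x ∈ U`. The tree's `PeriodRank.exists_submodule_finrank_le_two_of_real`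
  shows `dim_K U ≥ dim_ℝ(real shadow) = dim_ℝ ∑ range(Tᵢ − aᵢ)^∨ = n − 2` (annihilator of the line `ℂf`); as the values `φⱼ(f)` span `ℂ` over `ℝ`,
  `dim_K(values) ≥ 2`, so `dim_K ker ≤ n − 2 ≤ dim_K U` and `U ⊆ ker` is an equality.
Consequence (next file): for a conjugate eigenform `f' = f^σ` (`Tᵢ f' = σ(aᵢ) f'`), `ker ev_f = U ⊆ ker ev^σ_{f'}` — every `K`-linear relation
among the periods of `f` on rational cycles transports, through `σ`, to `f'`. No named fact; nothing about modular forms is used here.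
References: [Shimura1977] Thm. 1; [Shimura1971] Thm. 7.14, §8.2; [CremonaAlgorithms1997] §2.10 (2.10.1).
-/

noncomputable section

open Module Submodule

namespace Literature.NumberTheory.EllipticCurves.ModularForms

namespace PeriodRank

variable {K : IntermediateField ℚ ℂ} {S : Type*} [AddCommGroup S] [Module ℂ S] {n : ℕ}
  {b : Module.Basis (Fin n) ℝ (Module.Dual ℂ S)} {ι : Type*} {T : ι → S →ₗ[ℂ] S} {t : ι → Fin n → Fin n → ℤ} {a : ι → K}

/-- A real-scalar combination of functionals evaluated: `(∑ₖ rₖ•φₖ)(g) = ∑ₖ rₖ·φₖ(g)`. [folklore] -/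
private theorem sum_real_smul_dual_apply (b : Module.Basis (Fin n) ℝ (Module.Dual ℂ S)) (r : Fin n → ℝ) (g : S) :
    (∑ k, r k • b k) g = ∑ k, ((r k : ℝ) : ℂ) * b k g := by
  rw [LinearMap.coe_sum, Finset.sum_apply]
  exact Finset.sum_congr rfl fun k _ ↦ by rw [LinearMap.smul_apply, Complex.real_smul]

/-- **The twisted evaluation kills the Hecke vectors**: if `Tᵢ^∨ φⱼ = ∑ₖ t i j k·φₖ` (integer matrix) and `Tᵢ g = σ(aᵢ)·g`, then
`∑ₖ σ(t i j k − δ_{kj} aᵢ)·φₖ(g) = φⱼ(Tᵢ g) − σ(aᵢ)φⱼ(g) = 0`. [folklore] -/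
private theorem sum_twist_heckeVec_eq_zero (ht : ∀ i j, (T i).dualMap (b j) = ∑ k, ((t i j k : ℤ) : ℝ) • b k) (σ : K →+* ℂ) {g : S}
    (hg : ∀ i, T i g = σ (a i) • g) (i : ι) (j : Fin n) :
    ∑ k, σ (((t i j k : ℤ) : K) - if k = j then a i else 0) * b k g = 0 := by
  classical
  have h1 : ∑ k, σ (((t i j k : ℤ) : K)) * b k g = (b j) (T i g) := by
    have := congrArg (fun φ : Module.Dual ℂ S ↦ φ g) (ht i j)
    simp only [LinearMap.dualMap_apply] at this
    rw [this, sum_real_smul_dual_apply]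
    exact Finset.sum_congr rfl fun k _ ↦ by simp
  simp only [map_sub, sub_mul, Finset.sum_sub_distrib, h1, hg i, map_smul, smul_eq_mul]
  simp [Finset.sum_ite_eq', apply_ite σ]

/-- **The twisted evaluation `x ↦ ∑ₖ σ(xₖ) φₖ(g)` vanishes on the whole Hecke span `U = ∑_{i,j} K·u_{i,j}`** whenever `Tᵢ g = σ(aᵢ) g`
(the transport step in Shimura's proof: the Hecke algebra acts `ℚ`-rationally on `H₁(X₀(N), ℚ)`). [cite: Shimura1977, Thm. 1 (proof, §3)] [cite: Shimura1971, Thm. 7.14] -/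
theorem sum_twist_eq_zero_of_mem_heckeSpan (ht : ∀ i j, (T i).dualMap (b j) = ∑ k, ((t i j k : ℤ) : ℝ) • b k) (σ : K →+* ℂ) {g : S}
    (hg : ∀ i, T i g = σ (a i) • g) {x : Fin n → K}
    (hx : x ∈ span K (Set.range fun p : ι × Fin n ↦ fun k ↦ ((t p.1 p.2 k : ℤ) : K) - if k = p.2 then a p.1 else 0)) :
    ∑ k, σ (x k) * b k g = 0 := by
  induction hx using Submodule.span_induction with
  | mem y hy =>
    obtain ⟨⟨i, j⟩, rfl⟩ := hy
    exact sum_twist_heckeVec_eq_zero ht σ hg i j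
  | zero => simp
  | add y z _ _ hy hz =>
    simp only [Pi.add_apply, map_add, add_mul, Finset.sum_add_distrib, hy, hz, add_zero]
  | smul c y _ hy =>
    simp only [Pi.smul_apply, smul_eq_mul, map_mul, mul_assoc, ← Finset.mul_sum, hy, mul_zero]

/-- **The real span of a `K`-subspace of `Kⁿ` read in `ℝⁿ` (coordinatewise real part; `K ⊆ ℝ`) has real dimension at most its
`K`-dimension** (a `K`-basis spans it over `ℝ`). [folklore] -/
private theorem finrank_span_re_image_le (hK : ∀ x : K, (x : ℂ).im = 0) (U : Submodule K (Fin n → K)) [FiniteDimensional K U] :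
    finrank ℝ (span ℝ ((fun x : Fin n → K ↦ fun k ↦ ((x k : K) : ℂ).re) '' (U : Set (Fin n → K)))) ≤ finrank K U := by
  classical
  set ρ : (Fin n → K) → (Fin n → ℝ) := fun x k ↦ ((x k : K) : ℂ).re with hρ
  have ρ_add : ∀ x y, ρ (x + y) = ρ x + ρ y := fun x y ↦ by funext k; simp [hρ]
  have ρ_smul : ∀ (c : K) x, ρ (c • x) = ((c : ℂ).re : ℝ) • ρ x := fun c x ↦ by funext k; simp [hρ, Complex.mul_re, hK c]
  have ρ_sum : ∀ {α : Type _} (s : Finset α) (c : α → K) (v : α → Fin n → K),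
      ρ (∑ l ∈ s, c l • v l) = ∑ l ∈ s, ((c l : ℂ).re : ℝ) • ρ (v l) := by
    intro α s c v
    induction s using Finset.induction_on with
    | empty => funext k; simp [hρ]
    | insert l s' hl ih => rw [Finset.sum_insert hl, Finset.sum_insert hl, ρ_add, ρ_smul, ih]
  let c := Module.finBasis K U
  let s : Finset (Fin n → ℝ) := Finset.univ.image fun l ↦ ρ ((c l : U) : Fin n → K)
  have hsub : ρ '' (U : Set (Fin n → K)) ⊆ span ℝ (s : Set (Fin n → ℝ)) := by
    rintro _ ⟨x, hx, rfl⟩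
    set y : Fin (finrank K U) → K := fun l ↦ c.repr ⟨x, hx⟩ l with hy
    have hsum : (∑ l, y l • c l : U) = ⟨x, hx⟩ := c.sum_repr ⟨x, hx⟩
    have hx' : x = ∑ l, y l • ((c l : U) : Fin n → K) := by
      have h := congrArg (fun u : U ↦ (u : Fin n → K)) hsum
      simp only [Submodule.coe_sum, Submodule.coe_smul] at h
      exact h.symm
    rw [hx', ρ_sum]
    refine Submodule.sum_mem _ fun l _ ↦ Submodule.smul_mem _ _ (subset_span ?_)
    simp [s]
  calc finrank ℝ (span ℝ (ρ '' (U : Set (Fin n → K))))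
      ≤ finrank ℝ (span ℝ (s : Set (Fin n → ℝ))) := Submodule.finrank_mono (span_le.mpr hsub)
    _ ≤ s.card := finrank_span_finset_le_card s
    _ ≤ Fintype.card (Fin (finrank K U)) := Finset.card_image_le.trans (by simp)
    _ = finrank K U := Fintype.card_fin _

/-- ★★ **Exactness of the Hecke span.** Let `K ⊆ ℂ` be a real subfield, `b = (φₖ)` a real basis of `S^∨` in which the `Tᵢ^∨` have integer
matrices `t i`, and `f ≠ 0` a joint eigenvector `Tᵢ f = aᵢ f`, `aᵢ ∈ K`, whose joint eigenspace is `ℂ f` and whose values `φₖ(f)` span `ℂ`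
over `ℝ`. Then every `x ∈ Kⁿ` with `∑ₖ xₖ φₖ(f) = 0` lies in the Hecke span `U = ∑ K·u_{i,j}`, `u_{i,j} = (t i j k − δ_{kj} aᵢ)_k`:
`U ⊆ ker`, `dim_K U ≥ n − 2` (its real shadow is `∑ᵢ range (Tᵢ − aᵢ)^∨`, the annihilator of the line `ℂf`), `dim_K ker ≤ n − 2`
(the values span `ℂ`) — Shimura's rationality of the periods via the Hecke algebra, run over `K_f`.
[cite: Shimura1971, Thm. 7.14 and §8.2] [cite: CremonaAlgorithms1997, §2.10 (2.10.1)] -/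
theorem mem_heckeSpan_of_sum_eq_zero (hK : ∀ x : K, (x : ℂ).im = 0)
    (ht : ∀ i j, (T i).dualMap (b j) = ∑ k, ((t i j k : ℤ) : ℝ) • b k) {f : S} (hf : f ≠ 0) (hTf : ∀ i, T i f = ((a i : K) : ℂ) • f)
    (hM1 : ∀ h : S, (∀ i, T i h = ((a i : K) : ℂ) • h) → h ∈ span ℂ ({f} : Set S))
    (hspan : span ℝ (Set.range fun k ↦ b k f) = ⊤)
    {x : Fin n → K} (hx : ∑ k, ((x k : K) : ℂ) * b k f = 0) :
    x ∈ span K (Set.range fun p : ι × Fin n ↦ fun k ↦ ((t p.1 p.2 k : ℤ) : K) - if k = p.2 then a p.1 else 0) := by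
  classical
  set U : Submodule K (Fin n → K) := span K (Set.range fun p : ι × Fin n ↦ fun k ↦ ((t p.1 p.2 k : ℤ) : K) - if k = p.2 then a p.1 else 0)
    with hUdef
  set ρ : (Fin n → K) → (Fin n → ℝ) := fun x k ↦ ((x k : K) : ℂ).re with hρ
  -- the `K`-linear evaluation
  let ev : (Fin n → K) →ₗ[K] ℂ :=
    { toFun := fun y ↦ ∑ k, ((y k : K) : ℂ) * b k f
      map_add' := fun y z ↦ by simp [Finset.sum_add_distrib, add_mul]
      map_smul' := fun c y ↦ by
        simp only [Pi.smul_apply, IntermediateField.smul_def, smul_eq_mul, RingHom.id_apply, Finset.mul_sum]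
        exact Finset.sum_congr rfl fun k _ ↦ by push_cast; ring }
  have hev : ∀ y, ev y = ∑ k, ((y k : K) : ℂ) * b k f := fun _ ↦ rfl
  -- finite-dimensionality
  haveI hWfin : Module.Finite ℝ (Module.Dual ℂ S) := Module.Finite.of_basis b
  haveI hWfinC : Module.Finite ℂ (Module.Dual ℂ S) := Module.Finite.of_restrictScalars_finite ℝ ℂ (Module.Dual ℂ S)
  haveI : FiniteDimensional ℂ S := (Module.finite_dual_iff ℂ).mp hWfinC
  -- the operators `ψᵢ = Tᵢ - aᵢ`, finitely many of which cut out `ℂ f`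
  let φ : ι → S →ₗ[ℂ] S := fun i ↦ T i - ((a i : K) : ℂ) • LinearMap.id
  have hφf : ∀ i, φ i f = 0 := fun i ↦ by
    simp only [φ, LinearMap.sub_apply, LinearMap.smul_apply, LinearMap.id_apply, hTf i, sub_self]
  have hker_le : (⨅ i, LinearMap.ker (φ i)) ≤ span ℂ ({f} : Set S) := by
    intro h hh
    rw [Submodule.mem_iInf] at hh
    refine hM1 h fun i ↦ ?_
    have := hh i
    rw [LinearMap.mem_ker] at this
    simpa only [φ, LinearMap.sub_apply, LinearMap.smul_apply, LinearMap.id_apply, sub_eq_zero] using this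
  obtain ⟨s, hs⟩ := exists_finset_iInf_eq fun i ↦ LinearMap.ker (φ i)
  let ψ : ↥s → S →ₗ[ℂ] S := fun i ↦ φ i
  have hEq : (⨅ i : ↥s, LinearMap.ker (ψ i)) = span ℂ ({f} : Set S) := by
    apply le_antisymm
    · have : (⨅ i : ↥s, LinearMap.ker (ψ i)) = ⨅ i ∈ s, LinearMap.ker (φ i) := by rw [iInf_subtype']
      rw [this, ← hs]
      exact hker_le
    · rw [span_singleton_le_iff_mem, Submodule.mem_iInf]
      exact fun i ↦ hφf i
  have hfinE : finrank ℂ (⨅ i : ↥s, LinearMap.ker (ψ i) : Submodule ℂ S) = 1 := by rw [hEq, finrank_span_singleton hf]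
  -- `Uc = ∑ range ψᵢ^∨` has real dimension `n - 2`
  let Uc : Submodule ℂ (Module.Dual ℂ S) := ⨆ i : ↥s, LinearMap.range (ψ i).dualMap
  have hUq : finrank ℂ (Module.Dual ℂ S ⧸ Uc) = 1 := by rw [finrank_dual_quotient_iSup_range_dualMap ψ, hfinE]
  have hUfin : finrank ℂ Uc + 1 = finrank ℂ (Module.Dual ℂ S) := by
    have := Submodule.finrank_quotient_add_finrank Uc
    omega
  have hnW : finrank ℝ (Module.Dual ℂ S) = n := by simpa using Module.finrank_eq_card_basis b
  have h2W : finrank ℝ (Module.Dual ℂ S) = 2 * finrank ℂ (Module.Dual ℂ S) := finrank_real_of_complex _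
  let Uℝ : Submodule ℝ (Module.Dual ℂ S) := Uc.restrictScalars ℝ
  have hUℝ : finrank ℝ Uℝ = 2 * finrank ℂ Uc := by
    let eU : Uℝ ≃ₗ[ℝ] Uc :=
      { toFun := fun x ↦ ⟨x.1, x.2⟩, invFun := fun x ↦ ⟨x.1, x.2⟩, map_add' := fun _ _ ↦ rfl, map_smul' := fun _ _ ↦ rfl,
        left_inv := fun _ ↦ rfl, right_inv := fun _ ↦ rfl }
    rw [eU.finrank_eq, finrank_real_of_complex Uc]
  have hUℝ' : finrank ℝ Uℝ + 2 = n := by omega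
  -- the real shadow of the Hecke span contains `Uℝ` (in `b`-coordinates)
  let V : Submodule ℝ (Fin n → ℝ) := span ℝ (ρ '' (U : Set (Fin n → K)))
  have hgen : ∀ (i : ↥s) (j : Fin n),
      (ψ i).dualMap (b j) = b.equivFun.symm (ρ (fun k ↦ ((t i j k : ℤ) : K) - if k = j then a i else 0)) := by
    intro i j
    rw [Module.Basis.equivFun_symm_apply]
    have h1 : (ψ i).dualMap (b j) = (T i).dualMap (b j) - (((a (i : ι) : K) : ℂ).re : ℝ) • b j := by
      ext h
      simp only [ψ, φ, LinearMap.dualMap_apply, LinearMap.sub_apply, LinearMap.smul_apply, LinearMap.id_apply, map_sub, map_smul,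
        smul_eq_mul, Complex.real_smul]
      congr 2
      exact (Complex.ext (by simp) (by simp [hK (a i)])).symm
    rw [h1, ht]
    have h2 : ∀ k, ρ (fun k ↦ ((t i j k : ℤ) : K) - if k = j then a (i : ι) else 0) k =
        ((t i j k : ℤ) : ℝ) - if k = j then ((a (i : ι) : K) : ℂ).re else 0 := by
      intro k
      simp only [hρ]
      split_ifs <;> simp
    simp only [h2, sub_smul, Finset.sum_sub_distrib, ite_smul, zero_smul, Finset.sum_ite_eq', Finset.mem_univ, if_true]
  have hUle : Uℝ ≤ V.map (b.equivFun.symm : (Fin n → ℝ) →ₗ[ℝ] Module.Dual ℂ S) := by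
    intro y hy
    change y ∈ Uc at hy
    induction hy using Submodule.iSup_induction' with
    | mem i y hy =>
      obtain ⟨z, rfl⟩ := hy
      have hz : z ∈ span ℝ (Set.range b) := by rw [b.span_eq]; trivial
      have hmap : (span ℝ (Set.range b)).map (((ψ i).dualMap).restrictScalars ℝ) ≤ V.map (b.equivFun.symm : (Fin n → ℝ) →ₗ[ℝ] _) := by
        rw [Submodule.map_span, span_le]
        rintro _ ⟨_, ⟨j, rfl⟩, rfl⟩
        refine ⟨ρ (fun k ↦ ((t i j k : ℤ) : K) - if k = j then a i else 0), subset_span ⟨_, subset_span ⟨⟨i, j⟩, rfl⟩, rfl⟩, ?_⟩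
        exact (hgen i j).symm
      exact hmap ⟨z, hz, rfl⟩
    | zero => exact zero_mem _
    | add y z _ _ hy hz => exact add_mem hy hz
  -- hence `dim_K U ≥ n - 2`
  haveI : FiniteDimensional K U := FiniteDimensional.finiteDimensional_submodule _
  have hUdim : n ≤ finrank K U + 2 := by
    have h1 : finrank ℝ Uℝ ≤ finrank ℝ V := by
      calc finrank ℝ Uℝ ≤ finrank ℝ (V.map (b.equivFun.symm : (Fin n → ℝ) →ₗ[ℝ] Module.Dual ℂ S)) := Submodule.finrank_mono hUle
        _ ≤ finrank ℝ V := Submodule.finrank_map_le _ _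
    have h2 : finrank ℝ V ≤ finrank K U := finrank_span_re_image_le hK U
    omega
  -- `dim_K ker ev ≤ n - 2`: the values span `ℂ` over `ℝ`
  have hR2 : 2 ≤ finrank K (LinearMap.range ev) := by
    haveI : FiniteDimensional K (LinearMap.range ev) := LinearMap.finiteDimensional_range _
    have h1 := finrank_real_span_le_finrank_of_real K hK (LinearMap.range ev)
    have h2 : span ℝ (Set.range fun k ↦ b k f) ≤ span ℝ ((LinearMap.range ev : Submodule K ℂ) : Set ℂ) := by
      rw [span_le]
      rintro _ ⟨k, rfl⟩
      refine subset_span ⟨(Pi.single k 1 : Fin n → K), ?_⟩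
      change (∑ k', (((Pi.single k 1 : Fin n → K) k' : K) : ℂ) * b k' f) = b k f
      rw [Finset.sum_eq_single k (fun k' _ hk' ↦ by rw [Pi.single_eq_of_ne hk']; simp) (fun h ↦ absurd (Finset.mem_univ k) h)]
      simp
    rw [hspan] at h2
    have h3 : finrank ℝ (span ℝ ((LinearMap.range ev : Submodule K ℂ) : Set ℂ)) = 2 := by
      rw [eq_top_iff.mpr h2, finrank_top, Complex.finrank_real_complex]
    omega
  have hrank := LinearMap.finrank_range_add_finrank_ker ev
  rw [Module.finrank_fin_fun] at hrank
  -- `U ⊆ ker ev` is an equality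
  have hle : U ≤ LinearMap.ker ev := fun y hy ↦ by
    rw [LinearMap.mem_ker, hev]
    have h := sum_twist_eq_zero_of_mem_heckeSpan ht (algebraMap K ℂ) (g := f) (fun i ↦ by rw [hTf i]; rfl) hy
    exact h
  have heq : U = LinearMap.ker ev := Submodule.eq_of_le_of_finrank_le hle (by omega)
  change x ∈ U
  rw [heq, LinearMap.mem_ker, hev]
  exact hx

end PeriodRank

end Literature.NumberTheory.EllipticCurves.ModularForms

end
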